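import Mathlib
import Summits.NavierStokesRegularity.NavierStokesRegularity.Theorems.LerayQuarterDissipationFiniteDissipationLiouvilleVorticityLThree
import HarnessLib

/-!
# Crux `FiniteDissipationLiouville` (stmt-NavierStokesRegularity-22144): INTERMITTENCY-TOLERANT
# thresholds — the explicit rungs of the line hold with the supremum over time replaced by the
# parabolic backward AVERAGE (weight `e^{−(s−σ)/2} dσ` in similarity time, i.e.
# `√(−t)/(2(−τ)^{3/2}) dτ` in physical time)

Theorems file of route `LerayQuarterDissipation` (lead prover g16; `--supports` the crux; portrait
fact for the registered stub `stub_envelopeCriticalLiouville` of skeleton `Lines/birth.lean`).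
Navier–Stokes regularity is NOT proved by anything here; no summit is.

`𝒟_{C,K}`: Type-I ancient mild fields `V` (KNSS gauge) with the quarter-rate law; `U = lerayOrbit V`,
`Ω = lerayVorticity V`, `Z_R = ∫φ_R²‖Ω‖²`, `Z_∞(s) = ∫‖Ω(s)‖²`, `KS = SNormLESNormFDerivOfEqConst ℝ³ volume 2`.
Every explicit threshold of the line (velocity `C < 1`, dissipation `θ(K)⁴ < 64/27`, vorticity
amplitude `C_ω < √3/4`, `L³`-vorticity `KS²V₃² < 3`, `L⁶`-velocity `KS²V₆⁴ < 64/27`) was obtained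
from the damped budget `Z_R' ≤ −½Z_R + b·m + LM/R` with a CONSTANT stretching coefficient `b` bounded
through a SUPREMUM over all times of the relevant scale-invariant norm. The backward ODE bound needs
much less: with a time-dependent coefficient `b(σ)` the ancient orbit obeys
`Z_R(s) ≤ m·∫_{−∞}^s e^{−(s−σ)/2} b(σ) dσ + 2LM/R`, so only the exponentially weighted BACKWARD
AVERAGE of `b` has to be small — intermittent excursions of the norm above the threshold are allowed.

* `le_of_deriv_le_neg_mul_add_fun` — the backward ODE bound with continuous forcing: `Z` bounded,
  `Z' ≤ −κZ + g`, `∫_a^s e^{−κ(s−σ)}g(σ)dσ ≤ G` for all `a ≤ s` ⇒ `Z ≤ G`;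
* `integral_sq_norm_lerayVorticity_le_of_forall_one_le_fun` — the four-term budget lemma of
  `…VorticityLThreeTools` with a CONTINUOUS time-dependent `Z_∞`-coefficient `b(σ)`: a uniform bound
  `Z_∞ ≤ m` improves to `(2a + B)·m`, `B = sup_{a ≤ s} ∫_a^s e^{−(s−σ)/2} b(σ) dσ`;
* **`lerayVorticity_eq_zero_of_cube_le_fun`, `eq_zero_of_vorticityLThree_avg_lt`** — THE AVERAGED
  `L³`-VORTICITY RUNG: if `∫‖Ω(σ)‖³ ≤ β(σ)³` for a continuous `β ≥ 0` with
  `∫_a^s e^{−(s−σ)/2} β(σ)² dσ ≤ A` for all `a ≤ s` and `KS²A < 6`, then `V ≡ 0` (constant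
  `β ≡ v` gives `A = 2v²`: the sup-rung `KS²v² < 3` of `…VorticityLThree`);
* **`lerayVorticity_eq_zero_of_vorticity_le_fun`, `eq_zero_of_vorticityAmplitude_avg_lt`** — THE
  AVERAGED VORTICITY-AMPLITUDE RUNG: if `‖Ω(σ,·)‖ ≤ γ(σ)` for a continuous `γ ≥ 0` with
  `∫_a^s e^{−(s−σ)/2} γ(σ) dσ ≤ Γ` for all `a ≤ s` and `(2/√3)Γ < 1`, i.e. the backward average of
  `(−t)‖ω(t)‖_∞` is `< √3/4`, then `V ≡ 0` (lead g15's sup-rung `C_ω < √3/4` is `γ ≡ C_ω`).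

In physical time `τ = −e^{−σ}` the weight `e^{−(s−σ)/2}dσ` is the probability density
`√(−t)·dτ/(2(−τ)^{3/2})` on `(−∞, t)`: the hypothetical minimal blow-up profile must keep its
scale-invariant vorticity norms above the thresholds ON PARABOLIC BACKWARD AVERAGE at some instant,
not merely at some instant of every window (`…Windows` files).

HONEST FRAMING. Necessary conditions on the HYPOTHETICAL singular profile; the majorants `β, γ` are
assumed continuous in similarity time only to make the time integrals elementary; nothing is removed
from the catalogued DSS wall (`TypeIDSSLiouville`, NECESSARY for the crux); nothing here bears on
Navier–Stokes regularity or blow-up.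

References: Koch–Nadirashvili–Seregin–Šverák, Acta Math. 203 (2009) §4–§6; folklore energy method
(Grönwall with integrable forcing).
-/

noncomputable section

set_option linter.dupNamespace false

namespace Summit.NavierStokesRegularity.NavierStokesRegularity.Theorems.FiniteDissipationLiouville.Averaged

open MeasureTheory Set Filter Topology Metric InnerProductSpace Function Real intervalIntegral
open scoped RealInnerProductSpace ContDiff ENNReal Laplacian
open Literature.Analysis Literature.Analysis.FluidPDE
open Summit.NavierStokesRegularity.NavierStokesRegularity.Theorems
open Summit.NavierStokesRegularity.NavierStokesRegularity.Theorems.GaussianGap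
open Summit.NavierStokesRegularity.NavierStokesRegularity.Theorems.SimilarityEnstrophy
open Summit.NavierStokesRegularity.NavierStokesRegularity.Theorems.SmallDissipationGap
open Summit.NavierStokesRegularity.NavierStokesRegularity.Theorems.FiniteDissipationLiouville.VorticityAmplitude
open Summit.NavierStokesRegularity.NavierStokesRegularity.Theorems.FiniteDissipationLiouville.VorticityLThree

variable {C : ℝ} {V : ℝ → (EuclideanSpace ℝ (Fin 3)) → (EuclideanSpace ℝ (Fin 3))}

/-! ### The backward ODE bound with continuous forcing -/

section ODE

/-- **Backward (ancient) ODE bound with forcing.** A differentiable `Z : ℝ → ℝ`, bounded above, with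
`Z' ≤ −κZ + g` on `ℝ` (`κ > 0`, `g` continuous) and `∫_a^s e^{−κ(s−σ)} g(σ) dσ ≤ G` for all `a ≤ s`,
satisfies `Z ≤ G` everywhere: `W(σ) = Z(σ)e^{κσ} − ∫_a^σ g(σ')e^{κσ'}dσ'` is non-increasing, so
`Z(s) ≤ Z(a)e^{−κ(s−a)} + ∫_a^s e^{−κ(s−σ)}g ≤ B⁺e^{−κ(s−a)} + G → G` as `a → −∞`. [folklore] -/
theorem le_of_deriv_le_neg_mul_add_fun {Z g : ℝ → ℝ} (hd : Differentiable ℝ Z)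
    (hbdd : ∃ B, ∀ s, Z s ≤ B) {κ G : ℝ} (hκ : 0 < κ) (hg : Continuous g)
    (hZ' : ∀ s, deriv Z s ≤ -κ * Z s + g s)
    (hG : ∀ a s : ℝ, a ≤ s → ∫ σ in a..s, Real.exp (-(κ * (s - σ))) * g σ ≤ G) :
    ∀ s, Z s ≤ G := by
  obtain ⟨B, hB⟩ := hbdd
  have hexpd : ∀ σ : ℝ, HasDerivAt (fun σ => Real.exp (κ * σ)) (Real.exp (κ * σ) * κ) σ := by
    intro σ
    have := ((hasDerivAt_id σ).const_mul κ).exp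
    simpa using this
  -- the integrand `h(σ) = g(σ) e^{κσ}` and its primitive from `a`
  have hh : Continuous fun σ => g σ * Real.exp (κ * σ) :=
    hg.mul (Real.continuous_exp.comp (continuous_const.mul continuous_id))
  intro s
  -- Step 1: for every `a ≤ s`, `Z s ≤ Z a · e^{-κ(s-a)} + G`
  have hstep : ∀ a : ℝ, a ≤ s → Z s ≤ Z a * Real.exp (-(κ * (s - a))) + G := by
    intro a has
    set W : ℝ → ℝ := fun σ => Z σ * Real.exp (κ * σ) - ∫ σ' in a..σ, g σ' * Real.exp (κ * σ')
      with hW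
    have hWd : ∀ σ, HasDerivAt W (deriv Z σ * Real.exp (κ * σ) + Z σ * (Real.exp (κ * σ) * κ) -
        g σ * Real.exp (κ * σ)) σ := by
      intro σ
      have h1 := ((hd σ).hasDerivAt).mul (hexpd σ)
      have h2 : HasDerivAt (fun σ => ∫ σ' in a..σ, g σ' * Real.exp (κ * σ')) (g σ * Real.exp (κ * σ)) σ :=
        intervalIntegral.integral_hasDerivAt_right (hh.intervalIntegrable _ _)
          hh.aestronglyMeasurable.stronglyMeasurableAtFilter hh.continuousAt
      exact h1.sub h2
    have hW' : ∀ σ, deriv W σ ≤ 0 := by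
      intro σ
      rw [(hWd σ).deriv]
      have hexp : 0 < Real.exp (κ * σ) := Real.exp_pos _
      have := mul_le_mul_of_nonneg_right (hZ' σ) hexp.le
      nlinarith
    have hanti : Antitone W := antitone_of_deriv_nonpos (fun σ => (hWd σ).differentiableAt) hW'
    have hWs := hanti has
    -- `W a = Z a e^{κ a}`
    have hWa : W a = Z a * Real.exp (κ * a) := by
      simp only [hW, intervalIntegral.integral_same, sub_zero]
    rw [hWa] at hWs
    -- unpack `W s ≤ Z a e^{κa}`
    have hWs' : Z s * Real.exp (κ * s) ≤
        Z a * Real.exp (κ * a) + ∫ σ' in a..s, g σ' * Real.exp (κ * σ') := by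
      have : W s = Z s * Real.exp (κ * s) - ∫ σ' in a..s, g σ' * Real.exp (κ * σ') := rfl
      linarith
    -- multiply by `e^{-κ s}`
    have hexps : 0 < Real.exp (-(κ * s)) := Real.exp_pos _
    have hmul := mul_le_mul_of_nonneg_right hWs' hexps.le
    have e1 : Z s * Real.exp (κ * s) * Real.exp (-(κ * s)) = Z s := by
      rw [mul_assoc, ← Real.exp_add, add_neg_cancel, Real.exp_zero, mul_one]
    have e2 : Z a * Real.exp (κ * a) * Real.exp (-(κ * s)) = Z a * Real.exp (-(κ * (s - a))) := by
      rw [mul_assoc, ← Real.exp_add]; congr 1; congr 1; ring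
    have e3 : (∫ σ' in a..s, g σ' * Real.exp (κ * σ')) * Real.exp (-(κ * s)) =
        ∫ σ in a..s, Real.exp (-(κ * (s - σ))) * g σ := by
      rw [← intervalIntegral.integral_mul_const]
      refine intervalIntegral.integral_congr fun σ _ => ?_
      show g σ * Real.exp (κ * σ) * Real.exp (-(κ * s)) = Real.exp (-(κ * (s - σ))) * g σ
      rw [mul_assoc, ← Real.exp_add, mul_comm]
      congr 1; congr 1; ring
    rw [add_mul, e1, e2, e3] at hmul
    linarith [hG a s has]
  -- Step 2: `a → -∞`
  have hlim : Tendsto (fun a : ℝ => max B 0 * Real.exp (-(κ * (s - a))) + G) atBot (𝓝 (0 + G)) := by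
    have h1 : Tendsto (fun a : ℝ => -(κ * (s - a))) atBot atBot := by
      have : (fun a : ℝ => -(κ * (s - a))) = fun a => κ * a + (-(κ * s)) := by
        funext a; ring
      rw [this]
      exact tendsto_atBot_add_const_right _ _ (tendsto_id.const_mul_atBot hκ)
    have h2 := Real.tendsto_exp_atBot.comp h1
    have h3 : Tendsto (fun a : ℝ => max B 0 * Real.exp (-(κ * (s - a)))) atBot (𝓝 0) := by
      simpa using h2.const_mul (max B 0)
    exact h3.add tendsto_const_nhds
  rw [zero_add] at hlim
  refine ge_of_tendsto hlim (eventually_atBot.2 ⟨s, fun a has => ?_⟩)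
  calc Z s ≤ Z a * Real.exp (-(κ * (s - a))) + G := hstep a has
    _ ≤ max B 0 * Real.exp (-(κ * (s - a))) + G := by
        have := mul_le_mul_of_nonneg_right ((hB a).trans (le_max_left B 0)) (Real.exp_pos (-(κ * (s - a)))).le
        linarith

/-- The weight has total mass `≤ 1/κ`: `∫_a^s e^{−κ(s−σ)} dσ = (1 − e^{−κ(s−a)})/κ ≤ 1/κ`
(`κ > 0`; any `a, s`). [folklore] -/
theorem integral_exp_weight_le {κ : ℝ} (hκ : 0 < κ) (a s : ℝ) :
    ∫ σ in a..s, Real.exp (-(κ * (s - σ))) ≤ 1 / κ := by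
  have hderiv : ∀ σ ∈ Set.uIcc a s,
      HasDerivAt (fun σ => Real.exp (-(κ * (s - σ))) / κ) (Real.exp (-(κ * (s - σ)))) σ := by
    intro σ _
    have h1 : HasDerivAt (fun σ => -(κ * (s - σ))) κ σ := by
      have h := ((hasDerivAt_id σ).const_mul κ).sub_const (κ * s)
      have e : (fun x : ℝ => -(κ * (s - x))) = fun x => κ * id x - κ * s := by
        funext x; simp only [id]; ring
      rw [e]
      simpa using h
    have h2 := h1.exp.div_const κ
    have e : Real.exp (-(κ * (s - σ))) * κ / κ = Real.exp (-(κ * (s - σ))) := by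
      field_simp
    rwa [e] at h2
  have hcont : Continuous fun σ => Real.exp (-(κ * (s - σ))) :=
    Real.continuous_exp.comp ((continuous_const.mul (continuous_const.sub continuous_id)).neg)
  rw [intervalIntegral.integral_eq_sub_of_hasDerivAt hderiv (hcont.intervalIntegrable _ _)]
  simp only [sub_self, mul_zero, neg_zero, Real.exp_zero]
  have h0 : 0 < Real.exp (-(κ * (s - a))) := Real.exp_pos _
  have : Real.exp (-(κ * (s - a))) / κ > 0 := div_pos h0 hκ
  linarith

end ODE

/-! ### The budget with a time-dependent stretching coefficient -/

section Budget

/-- **One turn of the screw with a time-dependent `Z_∞`-coefficient.** Let `V ∈ 𝒟_{C,K}` satisfy, for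
all `σ` and all `R ≥ 1`, `2∫φ_R²⟪DUΩ,Ω⟫ ≤ 2∫φ_R²|∇Ω|²_F + aZ_R + b(σ)Z_∞(σ) + (c/R)∫_{B̄_{2R}}‖Ω‖²`
(`a, c ≥ 0`, `b ≥ 0` CONTINUOUS), let `∫_{a'}^s e^{−(s−σ)/2} b(σ) dσ ≤ B` for all `a' ≤ s`, and
`Z_∞ ≤ m` on the orbit. Then `Z_∞(s) ≤ (2a + B)·m` for all `s`: the budget reads
`Z_R' ≤ −½Z_R + (a·m + LM/R) + b(σ)m`, `le_of_deriv_le_neg_mul_add_fun` gives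
`Z_R ≤ 2(a·m + LM/R) + B·m`, and `R → ∞`. [folklore energy method] -/
theorem integral_sq_norm_lerayVorticity_le_of_forall_one_le_fun (hV : IsTypeIAncientMild C V) {K : ℝ}
    (hK : ∀ t : ℝ, t < 0 → ∫⁻ x, ‖fderiv ℝ (V t) x‖ₑ ^ 2 ≤ ENNReal.ofReal (K / Real.sqrt (-t)))
    {a c : ℝ} (ha : 0 ≤ a) (hc : 0 ≤ c) {b : ℝ → ℝ} (hb0 : ∀ σ, 0 ≤ b σ) (hbc : Continuous b)
    {B : ℝ} (hB : ∀ a' s : ℝ, a' ≤ s → ∫ σ in a'..s, Real.exp (-((1 / 2) * (s - σ))) * b σ ≤ B)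
    (hstr : ∀ σ : ℝ, ∀ R : ℝ, 1 ≤ R →
      2 * (∫ y, smoothTransition (2 - ‖y‖ ^ 2 / R ^ 2) ^ 2 *
        ⟪fderiv ℝ (lerayOrbit V σ) y (lerayVorticity V σ y), lerayVorticity V σ y⟫) ≤
        2 * (∫ y, smoothTransition (2 - ‖y‖ ^ 2 / R ^ 2) ^ 2 *
            frobeniusNormSq (fderiv ℝ (lerayVorticity V σ) y)) +
          a * (∫ y, smoothTransition (2 - ‖y‖ ^ 2 / R ^ 2) ^ 2 * ‖lerayVorticity V σ y‖ ^ 2) +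
          b σ * (∫ y, ‖lerayVorticity V σ y‖ ^ 2) +
          c / R * ∫ y in closedBall (0 : EuclideanSpace ℝ (Fin 3)) (2 * R), ‖lerayVorticity V σ y‖ ^ 2)
    {m : ℝ} (hm : ∀ s, ∫ y, ‖lerayVorticity V s y‖ ^ 2 ≤ m) (s : ℝ) :
    ∫ y, ‖lerayVorticity V s y‖ ^ 2 ≤ (2 * a + B) * m := by
  obtain ⟨c₁, hc₁0, hc₁⟩ :=
    exists_norm_fderiv_smoothTransition_cutoff_le (E := (EuclideanSpace ℝ (Fin 3)))
  obtain ⟨c₂, hc₂0, hc₂⟩ :=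
    exists_abs_laplacian_smoothTransition_cutoff_le (E := (EuclideanSpace ℝ (Fin 3)))
  have hC : 0 ≤ C := hV.nonneg
  have hΩi := fun σ => integrable_sq_norm_lerayVorticity hV hK σ
  set M : ℝ := ‖curlCLM‖ ^ 2 * max K 0 with hMdef
  have hM0 : 0 ≤ M := by positivity
  have hm0 : 0 ≤ m := (integral_nonneg fun y => sq_nonneg _).trans (hm s)
  have hB0 : 0 ≤ B := by
    have := hB s s le_rfl
    rwa [intervalIntegral.integral_same] at this
  set L : ℝ := 2 * C * c₁ + 2 * c₂ + 6 * c₁ ^ 2 + c with hLdef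
  have hL0 : 0 ≤ L := by positivity
  -- Step 1
  have hZ : ∀ R : ℝ, 1 ≤ R → ∀ σ : ℝ,
      (∫ y, smoothTransition (2 - ‖y‖ ^ 2 / R ^ 2) ^ 2 * ‖lerayVorticity V σ y‖ ^ 2) ≤
        2 * (a * m + L / R * M) + B * m := by
    intro R hR1
    have hR : 0 < R := lt_of_lt_of_le one_pos hR1
    have hd : Differentiable ℝ fun σ =>
        ∫ y, smoothTransition (2 - ‖y‖ ^ 2 / R ^ 2) ^ 2 * ‖lerayVorticity V σ y‖ ^ 2 :=
      fun σ => (hasDerivAt_sqCutoffEnstrophy hV hR σ).differentiableAt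
    have hle' : ∀ σ, (∫ y, smoothTransition (2 - ‖y‖ ^ 2 / R ^ 2) ^ 2 * ‖lerayVorticity V σ y‖ ^ 2) ≤
        ∫ y, ‖lerayVorticity V σ y‖ ^ 2 := by
      intro σ
      refine integral_mono_of_nonneg (Eventually.of_forall fun y =>
        mul_nonneg (sq_nonneg _) (sq_nonneg _)) (hΩi σ).1 (Eventually.of_forall fun y => ?_)
      have h1 := sqCutoff_le_one R y
      have h0 : 0 ≤ ‖lerayVorticity V σ y‖ ^ 2 := sq_nonneg _
      nlinarith
    have hle : ∀ σ, (∫ y, smoothTransition (2 - ‖y‖ ^ 2 / R ^ 2) ^ 2 * ‖lerayVorticity V σ y‖ ^ 2) ≤ M :=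
      fun σ => (hle' σ).trans (hΩi σ).2
    have hI : ∀ σ, (∫ y in closedBall (0 : EuclideanSpace ℝ (Fin 3)) (2 * R), ‖lerayVorticity V σ y‖ ^ 2) ≤ M :=
      fun σ => (setIntegral_le_integral (hΩi σ).1 (Eventually.of_forall fun y => sq_nonneg _)).trans (hΩi σ).2
    -- the budget with forcing `g(σ) = (a m + L M / R) + b(σ) m`
    have hZ' : ∀ σ, deriv (fun σ' =>
        ∫ y, smoothTransition (2 - ‖y‖ ^ 2 / R ^ 2) ^ 2 * ‖lerayVorticity V σ' y‖ ^ 2) σ ≤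
        -(1 / 2) * (∫ y, smoothTransition (2 - ‖y‖ ^ 2 / R ^ 2) ^ 2 * ‖lerayVorticity V σ y‖ ^ 2) +
          ((a * m + L / R * M) + b σ * m) := by
      intro σ
      rw [deriv_sqCutoffEnstrophy_eq hV hR σ]
      set φ : (EuclideanSpace ℝ (Fin 3)) → ℝ := fun z => smoothTransition (2 - ‖z‖ ^ 2 / R ^ 2) with hφdef
      set Ω := lerayVorticity V σ with hΩdef
      set U := lerayOrbit V σ with hUdef
      set I : ℝ := ∫ y in closedBall (0 : (EuclideanSpace ℝ (Fin 3))) (2 * R), ‖Ω y‖ ^ 2 with hIdef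
      set Z : ℝ := ∫ y, φ y ^ 2 * ‖Ω y‖ ^ 2 with hZdef
      have hI0 : 0 ≤ I := integral_nonneg fun y => sq_nonneg _
      have hIM : I ≤ M := hI σ
      have hZ0 : 0 ≤ Z := integral_nonneg fun y => mul_nonneg (sq_nonneg _) (sq_nonneg _)
      have hZm : Z ≤ m := (hle' σ).trans (hm σ)
      have hΩ1 : ContDiff ℝ 1 Ω := signedBudget_contDiff_lerayVorticity_slice hV σ (n := 1)
      have hcΩ : Continuous Ω := hΩ1.continuous
      have hUC : ∀ y, ‖U y‖ ≤ C := fun y => norm_lerayOrbit_le_of_typeI hV σ y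
      have hw1 : ContDiff ℝ 1 fun z : (EuclideanSpace ℝ (Fin 3)) => φ z ^ 2 := contDiff_sqCutoff (n := 1) R
      have hw2 : ContDiff ℝ 2 fun z : (EuclideanSpace ℝ (Fin 3)) => φ z ^ 2 := contDiff_sqCutoff (n := 2) R
      have hcDw : Continuous (fderiv ℝ fun z : (EuclideanSpace ℝ (Fin 3)) => φ z ^ 2) :=
        hw1.continuous_fderiv one_ne_zero
      have hDrift : (∫ y, fderiv ℝ (fun z : (EuclideanSpace ℝ (Fin 3)) => φ z ^ 2) y y * ‖Ω y‖ ^ 2) ≤ 0 :=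
        integral_nonpos fun y => mul_nonpos_iff.2 (Or.inr ⟨fderiv_sqCutoff_self_nonpos R y, sq_nonneg _⟩)
      have hT : |∫ y, fderiv ℝ (fun z : (EuclideanSpace ℝ (Fin 3)) => φ z ^ 2) y (U y) * ‖Ω y‖ ^ 2| ≤
          C * (2 * (c₁ / R)) * I := by
        refine abs_integral_le_of_weight_sq hcΩ (w := fun y => C * ‖fderiv ℝ (fun z : (EuclideanSpace ℝ (Fin 3)) => φ z ^ 2) y‖)
          (continuous_const.mul hcDw.norm) (fun y hy => ?_) (fun y _ => ?_) (fun y => ?_)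
        · show C * ‖fderiv ℝ (fun z : (EuclideanSpace ℝ (Fin 3)) => φ z ^ 2) y‖ = 0
          rw [hφdef, fderiv_sqCutoff_eq_zero hR hy, norm_zero, mul_zero]
        · exact mul_le_mul_of_nonneg_left (norm_fderiv_sqCutoff_le hc₁ hR y) hC
        · rw [abs_mul, abs_of_nonneg (sq_nonneg ‖Ω y‖)]
          have e1 : |fderiv ℝ (fun z : (EuclideanSpace ℝ (Fin 3)) => φ z ^ 2) y (U y)| ≤
              ‖fderiv ℝ (fun z : (EuclideanSpace ℝ (Fin 3)) => φ z ^ 2) y‖ * C := by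
            rw [← Real.norm_eq_abs]
            exact (ContinuousLinearMap.le_opNorm _ _).trans
              (mul_le_mul_of_nonneg_left (hUC y) (norm_nonneg _))
          calc |fderiv ℝ (fun z : (EuclideanSpace ℝ (Fin 3)) => φ z ^ 2) y (U y)| * ‖Ω y‖ ^ 2
              ≤ (‖fderiv ℝ (fun z : (EuclideanSpace ℝ (Fin 3)) => φ z ^ 2) y‖ * C) * ‖Ω y‖ ^ 2 :=
                mul_le_mul_of_nonneg_right e1 (sq_nonneg _)
            _ = C * ‖fderiv ℝ (fun z : (EuclideanSpace ℝ (Fin 3)) => φ z ^ 2) y‖ * ‖Ω y‖ ^ 2 := by ring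
      have hVisc : |∫ y, ‖Ω y‖ ^ 2 * (Δ (fun z : (EuclideanSpace ℝ (Fin 3)) => φ z ^ 2)) y| ≤
          (2 * (c₂ / R ^ 2) + 6 * (c₁ / R) ^ 2) * I := by
        refine abs_integral_le_of_weight_sq hcΩ (w := fun y => |(Δ (fun z : (EuclideanSpace ℝ (Fin 3)) => φ z ^ 2)) y|)
          (continuous_laplacian hw2).abs (fun y hy => ?_) (fun y _ => ?_) (fun y => ?_)
        · show |(Δ (fun z : (EuclideanSpace ℝ (Fin 3)) => φ z ^ 2)) y| = 0
          rw [hφdef, laplacian_sqCutoff_eq_zero hR hy, abs_zero]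
        · exact abs_laplacian_sqCutoff_le hc₁ hc₂ hR y
        · rw [abs_mul, abs_of_nonneg (sq_nonneg ‖Ω y‖), mul_comm]
      have hS := hstr σ R hR1
      have hSa : a * Z ≤ a * m := mul_le_mul_of_nonneg_left hZm ha
      have hSb : b σ * ∫ y, ‖lerayVorticity V σ y‖ ^ 2 ≤ b σ * m := mul_le_mul_of_nonneg_left (hm σ) (hb0 σ)
      have hSc : c / R * I ≤ c / R * M := mul_le_mul_of_nonneg_left hIM (div_nonneg hc hR.le)
      have hT' := (le_abs_self _).trans hT
      have hVisc' := (le_abs_self _).trans hVisc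
      have hR2 : 1 / R ^ 2 ≤ 1 / R := by
        rw [div_le_div_iff₀ (by positivity) hR]
        nlinarith
      have hc₂R : c₂ / R ^ 2 ≤ c₂ / R := by
        have := mul_le_mul_of_nonneg_left hR2 hc₂0
        simpa only [mul_one_div] using this
      have hc₁R : (c₁ / R) ^ 2 ≤ c₁ ^ 2 / R := by
        rw [div_pow]
        have := mul_le_mul_of_nonneg_left hR2 (sq_nonneg c₁)
        simpa only [mul_one_div] using this
      have a1 : C * (2 * (c₁ / R)) * I ≤ C * (2 * (c₁ / R)) * M :=
        mul_le_mul_of_nonneg_left hIM (by positivity)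
      have a2 : (2 * (c₂ / R ^ 2) + 6 * (c₁ / R) ^ 2) * I ≤ (2 * (c₂ / R) + 6 * (c₁ ^ 2 / R)) * M :=
        (mul_le_mul_of_nonneg_right (by linarith [hc₂R, hc₁R]) hI0).trans
          (mul_le_mul_of_nonneg_left hIM (by positivity))
      have e : L / R * M =
          C * (2 * (c₁ / R)) * M + (2 * (c₂ / R) + 6 * (c₁ ^ 2 / R)) * M + c / R * M := by
        rw [hLdef]; field_simp; ring
      rw [e]
      linarith [hDrift, hT', hVisc', hS, hSa, hSb, hSc, a1, a2]
    -- the forcing is continuous and its weighted backward integrals are bounded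
    have hgc : Continuous fun σ => (a * m + L / R * M) + b σ * m :=
      continuous_const.add (hbc.mul continuous_const)
    have hG : ∀ a' σ₁ : ℝ, a' ≤ σ₁ →
        ∫ σ in a'..σ₁, Real.exp (-((1 / 2) * (σ₁ - σ))) * ((a * m + L / R * M) + b σ * m) ≤
          2 * (a * m + L / R * M) + B * m := by
      intro a' σ₁ ha'
      have hwc : Continuous fun σ => Real.exp (-((1 / 2) * (σ₁ - σ))) :=
        Real.continuous_exp.comp ((continuous_const.mul (continuous_const.sub continuous_id)).neg)
      have i1 : IntervalIntegrable (fun σ => Real.exp (-((1 / 2) * (σ₁ - σ))) * (a * m + L / R * M))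
          volume a' σ₁ := (hwc.mul continuous_const).intervalIntegrable _ _
      have i2 : IntervalIntegrable (fun σ => Real.exp (-((1 / 2) * (σ₁ - σ))) * b σ * m)
          volume a' σ₁ := ((hwc.mul hbc).mul continuous_const).intervalIntegrable _ _
      have hsplit : (fun σ => Real.exp (-((1 / 2) * (σ₁ - σ))) * ((a * m + L / R * M) + b σ * m)) =
          fun σ => Real.exp (-((1 / 2) * (σ₁ - σ))) * (a * m + L / R * M) +
            Real.exp (-((1 / 2) * (σ₁ - σ))) * b σ * m := by
        funext σ; ring
      rw [hsplit, intervalIntegral.integral_add i1 i2, intervalIntegral.integral_mul_const,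
        intervalIntegral.integral_mul_const]
      have hw := integral_exp_weight_le (κ := 1 / 2) (by norm_num) a' σ₁
      have hamL : 0 ≤ a * m + L / R * M := by positivity
      have h1 : (∫ σ in a'..σ₁, Real.exp (-((1 / 2) * (σ₁ - σ)))) * (a * m + L / R * M) ≤
          2 * (a * m + L / R * M) := by
        have := mul_le_mul_of_nonneg_right hw hamL
        linarith [show (1 / (1 / 2 : ℝ)) * (a * m + L / R * M) = 2 * (a * m + L / R * M) by ring]
      have h2 : (∫ σ in a'..σ₁, Real.exp (-((1 / 2) * (σ₁ - σ))) * b σ) * m ≤ B * m :=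
        mul_le_mul_of_nonneg_right (hB a' σ₁ ha') hm0
      linarith
    exact le_of_deriv_le_neg_mul_add_fun hd ⟨M, hle⟩ (by norm_num : (0:ℝ) < 1 / 2) hgc hZ' hG
  -- Step 2: balls
  have hcΩ : Continuous (lerayVorticity V s) :=
    (signedBudget_contDiff_lerayVorticity_slice hV s (n := 1)).continuous
  have hball : ∀ n : ℕ, 1 ≤ (n : ℝ) →
      (∫ y in closedBall (0 : EuclideanSpace ℝ (Fin 3)) n, ‖lerayVorticity V s y‖ ^ 2) ≤
        2 * (a * m + L / n * M) + B * m := by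
    intro n hn
    have hR : 0 < (n : ℝ) := lt_of_lt_of_le one_pos hn
    refine le_trans ?_ (hZ n hn s)
    have hint : Integrable fun y => smoothTransition (2 - ‖y‖ ^ 2 / (n : ℝ) ^ 2) ^ 2 *
        ‖lerayVorticity V s y‖ ^ 2 :=
      (((contDiff_sqCutoff (n := 1) (n : ℝ)).continuous).mul (hcΩ.norm.pow 2)).integrable_of_hasCompactSupport
        ((hasCompactSupport_sqCutoff hR).mul_right)
    calc (∫ y in closedBall (0 : EuclideanSpace ℝ (Fin 3)) n, ‖lerayVorticity V s y‖ ^ 2)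
        = ∫ y in closedBall (0 : EuclideanSpace ℝ (Fin 3)) n,
            smoothTransition (2 - ‖y‖ ^ 2 / (n : ℝ) ^ 2) ^ 2 * ‖lerayVorticity V s y‖ ^ 2 := by
          refine setIntegral_congr_fun measurableSet_closedBall fun y hy => ?_
          rw [mem_closedBall, dist_zero_right] at hy
          rw [sqCutoff_eq_one hR hy, one_mul]
      _ ≤ ∫ y, smoothTransition (2 - ‖y‖ ^ 2 / (n : ℝ) ^ 2) ^ 2 * ‖lerayVorticity V s y‖ ^ 2 :=
          setIntegral_le_integral hint (Eventually.of_forall fun y =>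
            mul_nonneg (sq_nonneg _) (sq_nonneg _))
  have hlim : Tendsto (fun n : ℕ =>
      ∫ y in closedBall (0 : EuclideanSpace ℝ (Fin 3)) n, ‖lerayVorticity V s y‖ ^ 2) atTop
      (𝓝 (∫ y, ‖lerayVorticity V s y‖ ^ 2)) := by
    have h := tendsto_setIntegral_of_monotone (μ := (volume : Measure (EuclideanSpace ℝ (Fin 3))))
      (s := fun n : ℕ => closedBall (0 : EuclideanSpace ℝ (Fin 3)) n)
      (f := fun y => ‖lerayVorticity V s y‖ ^ 2) (fun n => measurableSet_closedBall)
      (fun m n hmn => closedBall_subset_closedBall (by exact_mod_cast hmn))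
      (by rw [iUnion_closedBall_nat]; exact (hΩi s).1.integrableOn)
    rwa [iUnion_closedBall_nat, Measure.restrict_univ] at h
  have hlim0 : Tendsto (fun n : ℕ => 2 * (a * m + L / n * M) + B * m) atTop
      (𝓝 (2 * (a * m + 0 * M) + B * m)) :=
    ((((tendsto_const_div_atTop_nhds_zero_nat L).mul_const M).const_add _).const_mul _).add_const _
  have hE := le_of_tendsto_of_tendsto hlim hlim0 (Filter.eventually_atTop.2 ⟨1, fun n hn => hball n
      (by exact_mod_cast hn)⟩)
  have e : 2 * (a * m + 0 * M) + B * m = (2 * a + B) * m := by ring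
  rwa [e] at hE

end Budget

end Summit.NavierStokesRegularity.NavierStokesRegularity.Theorems.FiniteDissipationLiouville.Averaged

end
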